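import Literature.NumberTheory.EllipticCurves.Hsieh2012.NonvanishingHeckeLValuesModP
import HarnessLib

/-!
# W. He, *Stability of `p`-adic valuations of Hecke `L`-values*, Math. Ann. 392 (2025) 399–468
# (doi:10.1007/s00208-024-03078-2 = arXiv:2308.15051), Theorem 1.4 (2) = Theorem 6.1 (2) in the
# SELF-DUAL, SPLIT-`𝔩` case — a NAMED FACT typed in the vocabulary of
# `Hsieh2012/NonvanishingHeckeLValuesModP.lean`

Topic `Literature/NumberTheory/EllipticCurves` (namespace = path + paper key `HeWei2025`; bib key
`HeWei2025MathAnn` — NB the bib key `He2025` is a different author). STATEMENT FILE (D-0064: one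
file for the one result the BSD wall consumes): two small definitions with bodies (the `ℤ_ℓ`-free
part `Γ̂` of Hsieh's family `X⁻_𝔩`, and the conclusion "integral off a finite set, unit values
infinitely often"), and ONE named fact (`def … : Prop`, cited, nothing asserted; D-0014). No
`sorry`, no `instance`, no notation, no `_holds` (proof = Hida's density of ordinary CM points on a
non-maximal-level integral model of the Hilbert modular scheme, Waldspurger formulae for
Eisenstein series with test vectors of level at `p`, Manin–Mumford for tori — SIZE XL ⇒ cite).
The bookkeeping theorems (`nvInfinite_of_nv`: Hsieh's (NV) ⇒ the He-shaped conclusion;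
`nvInfinite_of_rem69` / `nvInfinite_of_thm14`: the delta to Hsieh 2012 is exactly one binder;
closure properties of `Γ̂`) are in the sibling `PStabilityHeckeLValuesProofs.lean`.
Requested by the BSD wall (D-0154 KEY (146) §C INPUTS, `--supports` item 21341, BED FIRST ENTRY
A3′ of `INPUTS-LIST-1-ADDENDUM-1/2`): typed from the planner's checked sketch (crux workfile
`Cruxes/EisensteinHeartFlatCMInertBadKPrime/INPUTS_SKETCH_HeWei2025.lean`, commit 4949d2ce5272)
after a second reading of the e-print (§§1, 4.2–4.4 (`U_𝔠`, `Cl′_𝔠`, Theorem 4.16), 5.1–5.2,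
6.1–6.3) recorded below. It makes the citation nameable; it proves nothing about BSD.

## Why this fact and not Hsieh 2012 Thm. A (the BED point, INPUTS-LIST-1-ADDENDUM-1 §1.1–1.2)

Hsieh, Amer. J. Math. 134 (2012) Thm. A / Thm. 6.8 / Cor. 6.5 (typed next door as
`Hsieh2012.thmA_NV_of_isSelfDual`, `rem69_NV_of_isSelfDual`, `cor65_NV_of_not_isResiduallySelfDual`)
carry the standing hypothesis "`(p𝔩, D_{K/F}C) = 1`" (e-print p. 2, §6.1 p. 20), typed there as the
binder `∀ w, p ∈ w → χ.IsUnramifiedAt w`: the character must be UNRAMIFIED ABOVE `p`. On the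
`BiquadraticEisensteinDescent` branch of item 21341 the character is `Ψ = ψ_W ∘ N_{L/K_CM}` over the
biquadratic CM field `L = K_CM·K′` (`F = L⁺` real quadratic, `p ≥ 5` inert in `K_CM`, split in
`K′`, hence `v₀ = p𝒪_F` is a prime of `F` that SPLITS in `L/F` — `p` is ordinary — and
`𝔓𝔓^c = v₀𝒪_L` DIVIDES the conductor of `Ψ` because `W` has bad (additive, potentially good)
reduction at `p`). So Hsieh 2012 is documentation of the unramified mechanism only. He's theorem is
the same non-vanishing with "`we allow p to divide the conductor of Hecke character`" (p. 3 L10):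
it DROPS exactly that binder. It supplies the `L`-VALUE FACTOR of the lead's (C3-unit) (crux
workfile `Cruxes/EisensteinHeartFlatCMInertBadKPrime/HSIEH-AWAY-FROM-P-AUDIT.md` l. 51) and nothing
else: (C3) itself (the `Λ`-adic Fourier–Jacobi renormalisation / ramified Murase–Sugano integral)
is NOT IN PRINT. BSD is not proved by any of this; item 21341 is not closed by this.

## The printed statements (arXiv:2308.15051v?, `lit read` pagination = TeX chunks `p0003`…)

Setting (chunk p0003 L14–L27). "Let `p` be an ordinary prime in the sense that every prime of `F`
above `p` splits in `K`. Let `Σ` be a `p`-ordinary CM type of `K` … Let `𝔩` be a prime of `F` that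
prime to `p` and `Γ` [= "the Galois group of the maximal `ℤ_ℓ`-free quotient of the maximal
anticyclotomic extension of `K` with conductor `𝔩^∞`", L3]. View finite order characters
`ε ∈ Γ̂` on `Γ` as Hecke characters over `K` via the class field theory. Consider all Hecke
characters over `K` of infinite type `kΣ + (1−c)κ`, `kΣ + κ ∈ ℤ_{>0}[Σ]`, `κ ∈ ℤ_{≥0}[Σ]`. The group
`Γ̂` acts on this set. Fix a `Γ̂`-orbit denoted by `𝒳`, then it is known (see Theorem (measure) for
example) that for almost all `λ ∈ 𝒳`,
`𝓛(λ) = ∏_{w∈Σ_p} G(λ_w) · π^κ Γ_Σ(kΣ+κ) L_f(0,λ) / (√|D_F|_ℝ · Im(ϑ)^κ · Ω_∞^{kΣ+2κ}) ∈ ℤ̄_p ∩ ℚ̄`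
here (i) `Ω_∞ ∈ (ℂ^×)^Σ` is the CM period of a differential on an abelian scheme over `ℤ̄_p ∩ ℚ̄` of
CM type `(K, Σ)`; (ii) `ϑ` is any pure imaginary element in `K` such that `Im(σ(ϑ)) > 0` for each
`σ ∈ Σ` and `2ϑ𝒟_F^{-1}` is prime to `p` …; (iii) `G(λ_w)` is the Gauss sum
`|ϖ|_w^e · Σ_{u ∈ ϖ^{-e}(𝒪_{K_w}/ϖ^e 𝒪_{K_w})^×} λ_w(u)ψ_w(u)`, here `ϖ` is a uniformizer of `K_w`,
… `e` is the conductor of `λ_w` and `ψ_w` is a nontrivial additive character of `K_w` with trivial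
conductor; (iv) `Γ_Σ(Σ n_σ σ) = ∏ Γ(n_σ)`. Let `λ ∈ 𝒳`. Denote `d` the `ℤ_ℓ` rank of `Γ` and chose a
`ℤ_ℓ` basis `{e_i}` of `Γ`, we get an identification between `𝒳` and `𝔾_{m,ℚ̄}^d[ℓ^∞]` by
`λε ↦ (ε(e_i))_i`. Here for almost all means that except finitely many if `d = 1` and the image is
Zariski dense in `𝔾_{m,ℚ̄}^d` if `d > 1`."
Definition 1.1 (p0004 L1–L5). "(i) The character `λ` is called self-dual if `λ*|_{𝔸_F^×} = τ_{K/F}`,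
where `λ* := λ·|·|_{𝔸_K^×}^{−1/2}` …". Conjecture 1.2 (2) (p0004 L16–L19): "… write `𝒳 = 𝒳⁺ ⊔ 𝒳⁻`
with `𝒳^±` consists of those characters `λ ∈ 𝒳` with root number … equal to `±1` … exists
`μ_p(𝒳^ε) ∈ ℚ_{≥0} ⊔ {∞}` … Here we convention that `ord_p(0) = +∞`, and `μ_p(𝒳^ε) = +∞` if
`𝒳^ε = ∅`." Remark 1.3 (p0004 L21–L23): "In the self-dual case …, if `𝔩` is inert, then the parity
of root number … depends on the parity of conductor at `𝔩`. And if `𝔩` is split, then the root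
number … is constant. … Thus `μ_p(𝒳^ε) = +∞` only if `𝒳` is self-dual and `ε = −1`, or …".

* **Theorem 1.4** (p0004 L25–L46) = **Theorem 6.1** (p0028 L7–L17). "Assume (i). `p` is ordinary,
  `(p, D_F) = 1` (iii). `(𝔩, p) = 1` and `λ|_{F_𝔩^×}` is unramified for `λ ∈ 𝒳`, (iii). `p` odd if
  `𝒳` is residually self-dual but not self-dual, (iv). if `λ` is residually self-dual, `𝔩` inert,
  then `rank_{ℤ_ℓ}(Γ) = 1` then (1) … (2) If `𝒳` is self-dual, or `𝒳` is residually self-dual and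
  `p > 2`, then exists `μ_p(𝒳^ε)`, `ε = ±` such that for `m` with
  `μ_p(𝒳^m) = min{μ_p(𝒳⁺), μ_p(𝒳⁻)}`, we have `ord_p(𝓛(λ)) = μ_p(𝒳^m)` holds for for Zariski dense
  `λ ∈ 𝒳^m`." Thm. 6.1 adds: "Also denoted `𝒳*` by … `𝒳⁺`, if `𝒳` is self-dual …. The invariants
  `μ_p(𝒳*)` are given in section (pprop)", and §5.2.2 (p0025 L50–L55): "The Case `λ` is self-dual.
  … Let `μ_p(𝒳⁺) = Σ_{v ∈ S_n-split} μ_p(λ_v)`", with `S_n-split` = the finite NON-SPLIT places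
  `v ∤ 𝔩` of `F` where `λ|_{K_v^×}` is ramified (§4.4, p0017 L55: "Let `S_0 = {𝔩}` … Let `S_n-split`
  consists of nonsplit primes `v` of `F` such that `λ|_{K_v^×}` is ramified and `v ∤ 𝔩`"; the
  general shape `S = S_0 ⊔ S_split ⊔ S_n-split ⊔ S_∞ ⊔ S′` is §4.2, p0013 L59), and
  `μ_p(λ_v) := inf_{x ∈ K_v^×} (ord_p)(λ_v(x) − 1)`
  (p0023 L46; proof of Lemma 6.2, p0028 L34: "If exists `u ∈ 𝒪_{K,w}^×` such that `1 − λ_w(u)` is a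
  `p`-adic unit, then `μ_p(λ_w) = 0`").
* **Remark 1.5** (p0004 L48): "The assumption on `λ|_{F_𝔩^×}` is necessary …. The assumption that
  `(p, D_F) = 1` is only used in Hida's result on the density of CM points. In the case `rank_{ℤ_ℓ} Γ`
  is `1`, if strong density result holds (see Remark (sden)), one can replace the condition Zariski
  dense by except finitely many" — CONDITIONAL; NOT used below (we type "infinitely many").
* Cross-check (preprint, docstring only, not a fact): Burungale–He–Tian–Ye, arXiv:2508.19706 Thm. 5.2
  (TeX chunk p0029 L62–L76): for `λ` self-dual of infinity type `Σ + κ(1−c)`, `ℓ ∤ 2D_F`, `Σ`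
  `ℓ`-ordinary, `𝔭` a degree-one prime of `F`, `𝔭 ∤ ℓD_{K/F}`: (i) `v_ℓ(L^alg(1, λν)) ≥
  Σ_{v ∣ N(Cond λ) inert, v ∤ 𝔭} μ_ℓ(λ_v)` for all but finitely many `ν ∈ Ξ⁺_{λ,𝔭}`; (ii) `#Ξ⁺ = ∞` ⇒
  equality for infinitely many `ν`. "Proof. For `ℓ` coprime to the conductor of `λ` and `𝔭` split in
  `K`, this is [Hsieh]. For the remaining cases, see [He]." (their `(ℓ, 𝔭)` = our `(p, 𝔩)`).

## Transcription (binder by binder) and the deviations from print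

* (H1) Same dictionary as the sibling Hsieh 2012 file, (T1)–(T9) there: `K` CM (`IsCMField K`),
  `F = K⁺`; (i) "`p` ordinary, `Σ` `p`-ordinary" = `KatzCM.IsPAdicCMType p Σ_p` (it forces `cw ≠ w`
  for every `w ∣ p`, i.e. every prime of `F` above `p` splits in `K`), `(p, D_F) = 1` =
  `¬ p ∣ discr F`; "infinity type `Σ + κ(1−c)`" = `KatzCM.HasKatzType ι Σ_p χ 1 κ` (`k = 1` is forced
  by self-duality, sibling (T7)); self-dual = `Hsieh2012.IsSelfDual` (sibling (T7): He's
  Definition 1.1 (i) is verbatim Hsieh's); `𝔩 ∤ p` through a place `𝔏 ∣ ℓ ≠ p` of `K`.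
* (H2) We type the case **`𝔩 SPLIT in `K`** (`c𝔏 ≠ 𝔏`) **and `d = rank_{ℤ_ℓ} Γ = 1`**
  (`e(𝔏|ℓ) = f(𝔏|ℓ) = 1`, i.e. `F_𝔩 = K_𝔏 = ℚ_ℓ`: for split `𝔩` the anticyclotomic `ℤ_ℓ`-rank at
  `𝔩` is `[F_𝔩 : ℚ_ℓ]`) — the regime of the sibling facts and the one BED uses (the auxiliary `𝔩`
  is at the consumer's disposal). Then (iv) is void, (iii′) is void (self-dual), and by Remark 1.3
  the root number is CONSTANT on `𝒳`; with (R) `W(χ*) = +1` (`Hsieh2012.IsSelfDualRootNumber κ χ 1`,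
  sibling (T8): He's "root number of `λ`" is `ε(1/2, λ*)`, p0025 "by the assumption `ε(λ) = 1`",
  same `λ* = λ|·|^{-1/2}`) we get `𝒳 = 𝒳⁺`, `𝒳⁻ = ∅`, `μ_p(𝒳⁻) = +∞`, `m = +`.
* (H3) He's (iii) "`λ|_{F_𝔩^×}` unramified" is typed by the STRONGER `χ` unramified at `𝔏` and at
  `c𝔏` (as in the sibling; weaker fact, implied by print).
* (H4) (L) "`μ_p(χ_w) = 0` at every non-split ramified `w`" = `Hsieh2012.HasLocalMuZero ι χ w` for
  every `w` with `cw = w` and `χ` ramified at `w` (sibling (T6)); by §5.2.2 this gives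
  `μ_p(𝒳⁺) = Σ_{v∈S_n-split} μ_p(λ_v) = 0` (He's `μ_p(λ_v)` is Hsieh's, p0023 L46; `HasLocalMuZero`
  exhibits `x` with `ord_p(λ_v(x) − 1) = 0` and all values integral). Under (i) no place above `p` is
  non-split, so (L) never constrains the places above `p` — this is where "`p ∣ cond λ` allowed"
  enters: THERE IS NO BINDER "`χ` unramified above `p`" (the sibling's `∀ w, p ∈ w → χ.IsUnramifiedAt w`)
  and NO (C).
* (H5) EXTRA binder `2 < p`, NOT in print for the self-dual case (He's (iii′) asks `p` odd only
  for "residually self-dual but not self-dual"): added for safety — the consumers have `p ≥ 5`, and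
  the restatement Burungale–He–Tian–Ye arXiv:2508.19706 Thm. 5.2 does assume `ℓ ∤ 2D_F` (their `ℓ`
  = our `p`); the typed fact is weaker than print. A typer may drop it after re-reading §5–6 at
  `p = 2`.
* (C1) THE FAMILY. He's theorem is about ONE `Γ̂`-orbit, `Γ̂` = characters of the `ℤ_ℓ`-FREE
  quotient `Γ`. As Hecke characters these are the `ν ∈ X⁻_𝔩`
  (`Hsieh2012.lPowerAnticyclotomicFamily ℓ 𝔏`: `ℓ`-power order, anticyclotomic, unramified outside
  `{𝔏, c𝔏}`) that kill the (finite) torsion of `Γ⁻`, i.e. the infinitely `ℓ`-divisible ones inside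
  `X⁻_𝔩` (`Hom(ℤ_ℓ^d × T, ℚ_ℓ/ℤ_ℓ) = (ℚ_ℓ/ℤ_ℓ)^d × T̂`, divisible part `= Hom(Γ, ·)`):
  `lPowerAnticyclotomicFreeFamily ℓ 𝔏 := {ν ∈ X⁻_𝔩 | ∀ n, ∃ ν′ ∈ X⁻_𝔩, ν′^{ℓⁿ} = ν}`. Both clauses of
  the conclusion quantify over `χ · (this set)` = the orbit `𝒳` of `χ`. CHECK AGAINST §§4–6: He's
  `Γ` is "the maximal `ℤ_ℓ`-free quotient of `Cl′_∞ = lim_n Cl′_{𝔩ⁿ}`" (§6.1, p0028 L71; §4.4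
  p0022 L16) with `Cl′_𝔠 = 𝔸_K^×/K^×𝔸_F^×U_𝔠` (§4.3, p0015 L35) and
  `U_𝔠 = ∏_{v ∈ S_n-split ⊔ S_∞} K_v^× · Ô_𝔠^×` (§4.2, p0013 L66): so every `ε ∈ Γ̂` is TRIVIAL ON
  `𝔸_F^×` (hence `ε ∘ c = ε⁻¹`, and `λε` is self-dual with `λε|_{F_𝔩^×} = λ|_{F_𝔩^×}` — the
  hypotheses of Thm. 1.4 are orbit-invariant, as the statement presumes), of `ℓ`-power order,
  unramified outside `{𝔏, c𝔏}`, and kills the torsion `Δ` of `Cl′_∞ = Δ × Γ` (p0028 L77).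
  Conversely a member `ν` of the typed set is trivial on `𝔸_F^×` (`ν ∘ c = ν⁻¹` makes `ν|_{𝔸_F^×}`
  `2`-torsion, and it has `ℓ`-power order: trivial for odd `ℓ`; for `ℓ = 2` write `ν = ν′²` with
  `ν′` of the same kind), trivial on `K_v^×` at every non-split `v ∤ 𝔩` (inert: `K_v^× = F_v^×𝒪_{K_v}^×`;
  ramified in `K/F`, `ϖ_w² = uϖ_v`: `ν(ϖ_w)` is an `ℓ`-power root of unity with `ν(ϖ_w)² = 1`, so
  `= 1` for odd `ℓ`, and for `ℓ = 2` write `ν = ν″⁴`, `ν(ϖ_w) = (ν″(ϖ_v))² = 1`), hence a character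
  of `Cl′_∞`; being infinitely `ℓ`-divisible there it kills `Δ`: the typed set IS `Γ̂`, for every
  prime `ℓ` (including `ℓ = 2`).
* (C2) "ZARISKI DENSE" for `d = 1`: a subset of `𝔾_m[ℓ^∞] ⊂ 𝔾_m` is Zariski dense iff it is
  INFINITE, and `ε ↦ ε(e₁)` is injective on `Γ̂`; so Thm. 1.4 (2) says: INFINITELY MANY `ε ∈ Γ̂` have
  `ord_p 𝓛(χε) = μ_p(𝒳⁺) = 0` (proof of Thm. 6.1, §6.3.1: non-vanishing mod `𝔪_p` of
  `∫_Γ ε dφ_λ` for `ε` of conductor `𝔩^{n_i}` along an infinite sequence `n_i`, Cor. 6.12). We type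
  `Set.Infinite`, NOT "all but finitely many" (Remark 1.5 / Remark 6.10 make that conditional on a
  "strong density" result).
* (C3) INTEGRALITY: "for almost all `λ ∈ 𝒳`, `𝓛(λ) ∈ ℤ̄_p ∩ ℚ̄`" (p0003 L16–L21, "see Theorem
  (measure)" = Thm. 4.16, p0022 L23: a `p`-integral measure `φ_λ` on `Cl′_∞` with
  `Ω_p^{-(kΣ+2κ)} ∫ ε dφ_λ = ∏_{w∈S_1} G(λ_w) · π^κΓ_Σ(kΣ+κ) L_f^{(𝔩)}(0, ελ)/(√|D_F| Im ϑ^κ Ω_∞^{kΣ+2κ})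
  ∈ ℤ̄_p` for every finite-order `ε` on `Cl′_∞` — in the self-dual split-`𝔩` case `S_split,2 = ∅`,
  p0018 L1; `d = 1`: all but finitely many) — typed as: the set of `ν` in the family whose value
  has `‖ι⁻¹(·)‖ > 1` is finite (the weaker reading; we do not transcribe Thm. 4.16 itself).
* (C4) THE GAUSS SUM AND THE CONSTANTS ARE ABSORBED BY THE EXISTENTIAL PERIOD — the one genuine
  deviation, forced by the tree (no CM period object; sibling (T5)). He's `𝓛(χε)` and the sibling's
  Gauss-free `Hsieh2012.algebraicLValue 1 κ Ω 𝔏 (χε) L(0)` (`π^κ Γ_Σ L^{(𝔩)}(0,χε)/Ω^{Σ+2κ}`)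
  differ by the factor `c(ε) := ∏_{w∈Σ_p} G((χε)_w) · (√|D_F| Im(ϑ)^κ)^{-1} ·
  [L_f(0,χε)/L^{(𝔩)}(0,χε)]`. (a) `ε ∈ Γ̂` is unramified above `p` (`𝔩 ∤ p`), so `(χε)_w` has the
  conductor exponent `e = a(χ_w)` of `χ_w` and, substituting `u = ϖ^{-e}u₀` in (iii),
  `G((χε)_w) = ε_w(ϖ_w)^{-e} · G(χ_w)` with `ε_w(ϖ_w)` a root of unity: `‖ι⁻¹ ∏_w G((χε)_w)‖ =
  ‖ι⁻¹ ∏_w G(χ_w)‖ =: g > 0` is INDEPENDENT of `ε` (`G(χ_w) ≠ 0`: `|G| = N(w)^{-e/2}`).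
  (b) `√|D_F| Im(ϑ)^κ` is a non-zero constant. (c) `L_f` (primitive finite part, He) vs `L^{(𝔩)}`
  (Euler factors at `𝔏, c𝔏` removed, Hsieh): they differ only for `ε` UNRAMIFIED at `𝔏` (for `ε`
  ramified at `𝔏`, hence at `c𝔏`, the primitive Euler factors there are already `1`;
  `removedEulerFactorsAtZero` removes nothing where `χε` is ramified) — finitely many `ε` (the
  `ℓ`-class-group characters), and there by the `p`-INTEGRAL factor `(1 − χε(𝔏))(1 − χε(c𝔏))`
  (`𝔏 ∤ p`). Hence with `Ω′ := Ω_∞` rescaled at one infinite place `w₀` by a complex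
  `(1+2κ_{w₀})`-th root of `ι(y)`, `‖y‖ = g⁻¹·‖ι⁻¹(√|D_F| Im(ϑ)^κ)‖` (every value of `p^ℚ` is a norm
  in `ℚ̄_p`), the Gauss-free values satisfy: `‖ι⁻¹(value(ε))‖ ≤ 1` for all but finitely many `ε ∈ Γ̂`
  ((C3) and (c)) and `= 1` for infinitely many `ε ∈ Γ̂` (Thm. 1.4 (2), (C2); removing the finitely
  many `ε` of (c) keeps the set infinite). That is EXACTLY `NVInfinite ι ℓ 𝔏 χ 1 κ` below, with `Ω`
  existential: IMPLIED BY PRINT, WEAKER than print (print: `Ω = Ω_∞` and the common valuation is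
  `−ord_p ∏G(χ_w) + ord_p(√|D_F| Im ϑ^κ)`-shifted `0`). Its period-free content: the `p`-adic
  valuations of the Gauss-free algebraic values along `𝒳` are bounded below outside a finite set and
  the bound is attained infinitely often. The lead's audit §E (tame Gauss sum at `𝔓` of valuation
  `s`, Stickelberger) is the constant `g` here — consumers who need the value AT `Ω_∞` with the Gauss
  factor must re-anchor the normalisation (e.g. through a Katz-measure binder `KatzCM.IsMeasure … Ω …`).
  `-- TODO(general form): the conclusion at the CM period Ω_∞ with ∏_{w∈Σ_p} G(λ_w) explicit, once`
  `-- CM periods of abelian schemes of type (K, Σ) and local Gauss sums of Hecke characters exist.`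
* (C5) CONTINUATIONS. As in the sibling, the value `L(0, χε)` is that of an entire continuation
  supplied as a binder (`hL`), whose existence (Hecke) is not asserted: the finite (bad) set uses
  `∃ hL`, the infinite (good) set uses `∀ hL` — both the weak polarity (a `ν` without a typed
  continuation is never bad and always good), so the typed fact stays implied by print.

## What is NOT typed (deliberately)

Thm. 1.4 (1) (not residually self-dual; `μ_p(𝒳)` of §5.2.1) and (2)(ii) (residually self-dual,
`p > 2`, residual root numbers Def. 5.10); the inert-`𝔩` case ((iv), parity of conductors, `𝒳^±`
both infinite); `d > 1` (genuine Zariski density); the value of `μ_p(𝒳⁺) > 0` (we assume (L));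
the CM period and the Gauss sums as objects ((C4)); Remark 1.5's conditional "all but finitely
many"; BHTY 2025 Thm. 5.2 (preprint — cross-reference only); He's Theorem (measure) §4 and
Prop. (mod)/(mode) §3, §5. Nothing here is an existence claim about `L`-functions or periods.

## References

* [HeWei2025MathAnn] W. He, Math. Ann. 392 (2025), no. 1, 399–468, doi:10.1007/s00208-024-03078-2
  (Crossref) = arXiv:2308.15051 (held; all locators are e-print chunks, theorem numbers as in the
  e-print): p. 3 (setting, `𝓛(λ)`, `G(λ_w)`, "almost all"/"Zariski dense", "we allow `p` to divide
  the conductor"), Def. 1.1, Conj. 1.2, Rem. 1.3, Thm. 1.4, Rem. 1.5 (p. 4), §4.2 (`S_n-split`,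
  `U_𝔠`), §4.3 (`Cl′_𝔠`), Thm. 4.16 (the measure; integrality), §5.1 (Cor. 5.2, `μ_p(λ_v)`), §5.2.2
  (`μ_p(𝒳⁺)`), Thm. 6.1, Lemma 6.2, §6.2 (`Cl′_∞ = Δ × Γ`), §6.3.1 (proof, `d = 1`), Rem. 6.10.
* [Hsieh2012] M.-L. Hsieh, Amer. J. Math. 134 (2012) 1503–1539: the `(p, C) = 1` case (sibling file).
* Burungale–He–Tian–Ye, arXiv:2508.19706 (2025), Thm. 5.2 and ref. [He] (journal data) — not a fact.
* Tree: `Hsieh2012/NonvanishingHeckeLValuesModP.lean` (all vocabulary), `KatzPAdicLFunctionCMField.lean`.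
-/

noncomputable section

open scoped Classical
open NumberField IsDedekindDomain
open Literature.NumberTheory.GaloisRepresentations
open Literature.NumberTheory.EllipticCurves.Hsieh2012

namespace Literature.NumberTheory.EllipticCurves.HeWei2025

/-! ### §1. Vocabulary (two definitions on top of the Hsieh 2012 dictionary) -/

section Vocabulary

variable {K : Type} [Field K] [NumberField K] [IsCMField K] {p : ℕ} [Fact p.Prime]

/-- **He's `Γ̂` inside Hsieh's `X⁻_𝔩`** — the finite-order characters of `Γ` = "the Galois group of
the maximal `ℤ_ℓ`-free quotient of the maximal anticyclotomic extension of `K` with conductor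
`𝔩^∞`" (e-print p. 3 L3), viewed as Hecke characters: the members of
`Hsieh2012.lPowerAnticyclotomicFamily ℓ 𝔏` (`ℓ`-power order, anticyclotomic, unramified outside
`{𝔏, c𝔏}` = the finite-order characters of `Γ⁻ ≅ ℤ_ℓ^d × T`) that are infinitely `ℓ`-divisible
INSIDE that family, i.e. that kill the finite torsion `T` (module docstring (C1)). For `ℓ = 0` junk.
[cite: HeWei2025MathAnn, §1 p. 3 of the e-print (the group `Γ`, "finite order characters `ε ∈ Γ̂` … as Hecke characters over `K` via the class field theory")] -/
def lPowerAnticyclotomicFreeFamily (ℓ : ℕ) (𝔏 : HeightOneSpectrum (𝓞 K)) :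
    Set (HeckeCharacter K) :=
  {ν | ν ∈ lPowerAnticyclotomicFamily ℓ 𝔏 ∧
    ∀ n : ℕ, ∃ ν' ∈ lPowerAnticyclotomicFamily ℓ 𝔏, ν' ^ ℓ ^ n = ν}

/-- **"`ord_p 𝓛(χε)` is bounded below on the orbit and the bound is attained for infinitely many
`ε ∈ Γ̂`"** — the period-free, Gauss-sum-free reading of He's Thm. 1.4 (2) conclusion in rank
`d = 1` together with the integrality "for almost all `λ ∈ 𝒳`, `𝓛(λ) ∈ ℤ̄_p`" (module docstring
(C1)–(C5)): there is a period vector `Ω = (Ω_w)_w`, `Ω_w ≠ 0`, such that, writing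
`V(ε) = Hsieh2012.algebraicLValue k κ Ω 𝔏 (χε) (L(0, χε))` for the Gauss-free normalised value at
an entire continuation of `L(s, χε)`,
(a) the set of `ε ∈ Γ̂` admitting a continuation value with `‖ι⁻¹ V(ε)‖ > 1` is FINITE, and
(b) the set of `ε ∈ Γ̂` all of whose continuation values have `‖ι⁻¹ V(ε)‖ = 1` is INFINITE.
For `Ω = Ω_∞` suitably rescaled by ONE constant (the `ε`-independent `p`-adic size of
`∏_{w∈Σ_p} G(χ_w)/(√|D_F| Im ϑ^κ)`) this is implied by the printed statement; `Set.Infinite` is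
"Zariski dense in `𝔾_m[ℓ^∞]`" for `d = 1`. Compare `Hsieh2012.NV` (cofinitely many units, all
values integral): `NV` and `Γ̂` infinite imply `NVInfinite` (`nvInfinite_of_nv` in the sibling Proofs file).
[cite: HeWei2025MathAnn, Theorem 1.4 (2) (p. 4) with p. 3 ("for almost all `λ ∈ 𝒳`, `𝓛(λ) ∈ ℤ̄_p ∩ ℚ̄`"; "Zariski dense … if `d > 1`", "except finitely many if `d = 1`")] -/
def NVInfinite (ι : PadicAlgCl p ≃+* ℂ) (ℓ : ℕ) (𝔏 : HeightOneSpectrum (𝓞 K)) (χ : HeckeCharacter K)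
    (k : ℕ) (κ : InfinitePlace K → ℕ) : Prop :=
  ∃ Ω : InfinitePlace K → ℂ, (∀ w, Ω w ≠ 0) ∧
    {ν : HeckeCharacter K | ν ∈ lPowerAnticyclotomicFreeFamily ℓ 𝔏 ∧
      ∃ hL : LFunction.HasEntireContinuation (heckeLFunction (χ * ν)),
        1 < ‖ι.symm (algebraicLValue k κ Ω 𝔏 (χ * ν) (hL.continuation 0))‖}.Finite ∧
    {ν : HeckeCharacter K | ν ∈ lPowerAnticyclotomicFreeFamily ℓ 𝔏 ∧
      ∀ hL : LFunction.HasEntireContinuation (heckeLFunction (χ * ν)),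
        ‖ι.symm (algebraicLValue k κ Ω 𝔏 (χ * ν) (hL.continuation 0))‖ = 1}.Infinite

end Vocabulary

/-! ### §2. The named fact -/

section Facts

/-- **He 2025, Theorem 1.4 (2) = Theorem 6.1 (2), SELF-DUAL case with `𝔩` SPLIT in `K`,
`rank_{ℤ_ℓ} Γ = 1`, root number `+1` and (L) — `p` MAY DIVIDE THE CONDUCTOR of `χ`.**
Verbatim (Thm. 1.4): "Assume (i). `p` is ordinary, `(p, D_F) = 1` (iii). `(𝔩, p) = 1` and
`λ|_{F_𝔩^×}` is unramified for `λ ∈ 𝒳` … then … (2) If `𝒳` is self-dual, … then exists `μ_p(𝒳^ε)`,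
`ε = ±` such that for `m` with `μ_p(𝒳^m) = min{μ_p(𝒳⁺), μ_p(𝒳⁻)}`, we have
`ord_p(𝓛(λ)) = μ_p(𝒳^m)` holds for for Zariski dense `λ ∈ 𝒳^m`", read with Rem. 1.3 ("if `𝔩` is
split, then the root number is constant" — so (R) `W(χ*) = +1` gives `𝒳 = 𝒳⁺`, `m = +`), §5.2.2
(`μ_p(𝒳⁺) = Σ_{v∈S_n-split} μ_p(λ_v)`, `= 0` under (L)), p. 3 (integrality for almost all `λ ∈ 𝒳`;
"Zariski dense" = infinite for `d = 1`) and "we allow `p` to divide the conductor of Hecke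
character" (p. 3). Binders (module docstring (H1)–(H5)): `2 < p` (EXTRA, (H5)) with `p ∤ D_F`; `K` CM;
`Σ_p` a `p`-adic CM type ((i)); `ℓ ≠ p` prime, `𝔏 ∣ ℓ` a place of `K` with `c𝔏 ≠ 𝔏` (`𝔩` split)
and `e(𝔏|ℓ) = f(𝔏|ℓ) = 1` (`d = 1`); `χ` of infinity type `Σ + κ(1−c)`, self-dual, unramified at
`𝔏` and `c𝔏` ((iii), (H3)); (L) `μ_p(χ_w) = 0` at every non-split place where `χ` ramifies ((H4));
(R) `W(χ*) = +1`. NO binder "`χ` unramified above `p`", no (C) — compare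
`Hsieh2012.thmA_NV_of_isSelfDual` / `rem69_NV_of_isSelfDual`, whose extra binder
`∀ w, p ∈ w → χ.IsUnramifiedAt w` is exactly what fails on the BED branch. Conclusion
`NVInfinite ι ℓ 𝔏 χ 1 κ` ((C1)–(C5): orbit `χΓ̂`, period existential absorbing the Gauss sums and
constants, integral off a finite set, units on an infinite set — WEAKER than print).
`-- TODO(general form): 𝔩 inert / d > 1 / μ_p(𝒳⁺) > 0 / parts (1) and (2)(ii); value at Ω_∞ with`
`-- the Gauss factor ∏_{w∈Σ_p} G(λ_w) explicit.`
[cite: HeWei2025MathAnn, Theorem 1.4 (2) (p. 4) = Theorem 6.1 (2) (§6), with Remark 1.3, §5.2.2 (definition of `μ_p(𝒳⁺)`), §5.1 (`μ_p(λ_v)`), and p. 3 (setting: `𝓛(λ)`, integrality for almost all `λ`, "Zariski dense"/"except finitely many", "we allow `p` to divide the conductor")] -/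
def thm14_NVInfinite_of_isSelfDual : Prop :=
  ∀ (p : ℕ) [Fact p.Prime], 2 < p →
  ∀ (K : Type) [Field K] [NumberField K] [IsCMField K],
    ¬ (p : ℤ) ∣ NumberField.discr (maximalRealSubfield K) →
  ∀ (ι : PadicAlgCl p ≃+* ℂ) (Sp : Finset (HeightOneSpectrum (𝓞 K))), KatzCM.IsPAdicCMType p Sp →
  ∀ (ℓ : ℕ) (𝔏 : HeightOneSpectrum (𝓞 K)), ℓ.Prime → ℓ ≠ p → ((ℓ : ℕ) : 𝓞 K) ∈ 𝔏.asIdeal →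
    IsCMField.complexConj K • 𝔏 ≠ 𝔏 →
    𝔏.asIdeal.ramificationIdx ℤ = 1 → 𝔏.asIdeal.inertiaDeg ℤ = 1 →
  ∀ (χ : HeckeCharacter K) (κ : InfinitePlace K → ℕ),
    KatzCM.HasKatzType ι Sp χ 1 κ → IsSelfDual χ →
    χ.IsUnramifiedAt 𝔏 → χ.IsUnramifiedAt (IsCMField.complexConj K • 𝔏) →
    (∀ w : HeightOneSpectrum (𝓞 K), IsCMField.complexConj K • w = w → ¬ χ.IsUnramifiedAt w →
      HasLocalMuZero ι χ w) →
    IsSelfDualRootNumber κ χ 1 →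
    NVInfinite ι ℓ 𝔏 χ 1 κ

end Facts

end Literature.NumberTheory.EllipticCurves.HeWei2025

end
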